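import Summits.AnomalousDissipation.AnomalousDissipation.Theorems.SolenoidalFractalHomogenisationLagrangianStepCellClauseCuts
import HarnessLib

/-!
# K1L `LagrangianRenormalisationStep` / `LagrangianRenormalisationStepDesign` (stmt-AnomalousDissipation-24912 → K1L_D): the WINDOW-LOCAL re-cut (F_T) of
# the cell-energy clauses — definitions `CellEnergyClausesWNoE` / `CellEnergyClausesW` and the two adapters (helper; `--supports … --as helper`)

Summits-side definitions-and-adapters file of route `SolenoidalFractalHomogenisation` (objects the K1L line posits; no named facts, no sorry).
Landing item F0 of the tenure planner's LANDING LIST (cell `ad-ideate` STATUS 2026-08-28T13:04:46Z, tenure D24-4 / finding F-lead-1 of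
`lead-k1l-onelevel-p1`, texts by planner ad-ideate-p4 g9, crux workfile `Cruxes/LagrangianRenormalisationStep/CellEnergyFRecutSketch.lean`
commit 2ae7cbb2399c, copied VERBATIM into the shared namespace `…Theorems.SolenoidalFractalHomogenisation.LagrangianStep`):

* `CellEnergyClausesWNoE` / `CellEnergyClausesW` — `CellEnergyClausesNoE` (p629134) / `CellEnergyClauses` (p613864) verbatim except that the slow
  leakage conjunct of clause (F) carries the window-local growth factor: `lowEnergy L (u t) ≤ C·(cL²/(n²ν²))·exp(C·(L²/(n²ν))·t)·∫‖F‖²`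
  (one constant for prefactor and rate).  WHY (F-lead-1): the uniform-in-`T` leakage cannot follow from flux-magnitude energy methods (the block
  system `x' ≤ 2ηy`, `y' ≤ −λy + 2ηx` contains `e^{4η²t/λ}`); the window-local form is what the FastBlock machinery (p634526) proves, and on the
  active band of the one-level step the exponent is `O(ρ^{1/4})` (CellEnergyFRecutSketch `activeBand_exponent_le`).  Typing of record for
  `stub_cellEnergyT` (conclusion `…WNoE`) and `stub_oneLevelL(_I)` (hypothesis `…W`) from K1L_D skeleton v2 on (tenure ✓ ACK 13:04:46Z).
* `cellEnergyClausesW_of_noE` — the energy conjunct is free (`ae_energy_le_datum`, Temam's energy inequality for every weak cell solution).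
* `cellEnergyClausesW_of_cellEnergyClauses` — (F) ⇒ (F_T) (`exp ≥ 1`): the re-cut weakens `stub_cellEnergyT` and strengthens `stub_oneLevelL`'s hypothesis.

Infrastructure for route-1's rung leaf F-D1.A0 (a frontier FORMAL rung); NOT a proof of the crux, of Onsager's conjecture or of anomalous dissipation.
Landed by prover seat `ad-k3l-bookkeeping-p1` g3 (hands free after `stub_tailL`), 2026-08-28.
-/

set_option linter.dupNamespace false

namespace Summit.AnomalousDissipation.AnomalousDissipation.Theorems.SolenoidalFractalHomogenisation.LagrangianStep

open Literature.Analysis Literature.Analysis.FluidPDE Literature.Analysis.FunctionSpaces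
open MeasureTheory Set Filter
open scoped ENNReal NNReal InnerProductSpace

noncomputable section

/-- (F_T) + (C) WITHOUT the energy conjunct — candidate conclusion of `stub_cellEnergyT` (re-cut of `CellEnergyClausesNoE`, p629134): the slow
leakage from fluctuation data carries the window-local growth factor `exp(C·(L²/(n²ν))·t)`. -/
def CellEnergyClausesWNoE {k : ℕ} (W : LatticeShear.LatticeWord k) (M : ℝ) (hM : 0 < M) (c : ℝ) (lo hi Λ β C ν₀ K : ℝ) : Prop :=
      ∀ ν, ∀ hν : ν ∈ Set.Ioo 0 ν₀, ∀ n : ℕ, ∀ 𝔸 : Torus.Visc4 (Fin 3),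
        Torus.OddSmall 𝔸 (ν * β) → (∃ lam ∈ Set.Icc (1:ℝ) Λ, Torus.NearIso 𝔸 (ν * (lo / lam)) (ν * (hi * lam))) →
        (∀ L > (0:ℝ), L * (⌈K / ν⌉₊ : ℝ) ≤ n → ∀ F : VF, IsDatum F →
            (∀ k' : Fin 3 → ℤ, ‖Torus.latticeVec k'‖ < (n:ℝ) / 2 → ∀ i, modeCoeff k' F i = 0) →
            ∀ T > (0:ℝ), ∀ u : ℝ → VF, Torus.IsWeakTensorPassiveVectorOn 0 T ((1 / (n:ℝ) ^ 2) • 𝔸) (cellField W M hM ν hν.1 n) F u →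
              ∀ᵐ t ∂(volume.restrict (Ioo 0 T)),
                lowEnergy L (u t) ≤ C * (c * L ^ 2 / ((n:ℝ) ^ 2 * ν ^ 2)) * Real.exp (C * (L ^ 2 / ((n:ℝ) ^ 2 * ν)) * t) * ∫ x, ‖F x‖ ^ 2) ∧
        ∀ ℓ : Fin 3 → ℤ, ℓ ≠ 0 → ‖Torus.latticeVec ℓ‖ * (⌈K / ν⌉₊ : ℝ) ≤ n →
        ∀ p : EuclideanSpace ℝ (Fin 3), ‖p‖ = 1 → ⟪p, Torus.latticeVec ℓ⟫_ℝ = 0 →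
        ∀ T > (0:ℝ), ∀ w : ℝ → VF,
            Torus.IsWeakTensorPassiveVectorOn 0 T ((1 / (n:ℝ) ^ 2) • 𝔸) (cellField W M hM ν hν.1 n) (fun x => (UnitAddTorus.mFourier ℓ x).re • p) w →
            ∀ᵐ t ∂(volume.restrict (Ioo 0 T)),
              ∫ x, ‖w t x‖ ^ 2 - lowEnergy ((n:ℝ) / 2) (w t)
                  ≤ C * (c * ‖Torus.latticeVec ℓ‖ ^ 2 / ((n:ℝ) ^ 2 * ν ^ 2)) * ∫ x, ‖(UnitAddTorus.mFourier ℓ x).re • p‖ ^ 2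

/-- (F_T) + (C) WITH the energy conjunct — candidate hypothesis text of `stub_oneLevelL` (re-cut of `CellEnergyClauses`, OneLevelDefs). -/
def CellEnergyClausesW {k : ℕ} (W : LatticeShear.LatticeWord k) (M : ℝ) (hM : 0 < M) (c : ℝ) (lo hi Λ β C ν₀ K : ℝ) : Prop :=
      ∀ ν, ∀ hν : ν ∈ Set.Ioo 0 ν₀, ∀ n : ℕ, ∀ 𝔸 : Torus.Visc4 (Fin 3),
        Torus.OddSmall 𝔸 (ν * β) → (∃ lam ∈ Set.Icc (1:ℝ) Λ, Torus.NearIso 𝔸 (ν * (lo / lam)) (ν * (hi * lam))) →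
        (∀ L > (0:ℝ), L * (⌈K / ν⌉₊ : ℝ) ≤ n → ∀ F : VF, IsDatum F →
            (∀ k' : Fin 3 → ℤ, ‖Torus.latticeVec k'‖ < (n:ℝ) / 2 → ∀ i, modeCoeff k' F i = 0) →
            ∀ T > (0:ℝ), ∀ u : ℝ → VF, Torus.IsWeakTensorPassiveVectorOn 0 T ((1 / (n:ℝ) ^ 2) • 𝔸) (cellField W M hM ν hν.1 n) F u →
              ∀ᵐ t ∂(volume.restrict (Ioo 0 T)),
                ∫ x, ‖u t x‖ ^ 2 ≤ ∫ x, ‖F x‖ ^ 2 ∧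
                lowEnergy L (u t) ≤ C * (c * L ^ 2 / ((n:ℝ) ^ 2 * ν ^ 2)) * Real.exp (C * (L ^ 2 / ((n:ℝ) ^ 2 * ν)) * t) * ∫ x, ‖F x‖ ^ 2) ∧
        ∀ ℓ : Fin 3 → ℤ, ℓ ≠ 0 → ‖Torus.latticeVec ℓ‖ * (⌈K / ν⌉₊ : ℝ) ≤ n →
        ∀ p : EuclideanSpace ℝ (Fin 3), ‖p‖ = 1 → ⟪p, Torus.latticeVec ℓ⟫_ℝ = 0 →
        ∀ T > (0:ℝ), ∀ w : ℝ → VF,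
            Torus.IsWeakTensorPassiveVectorOn 0 T ((1 / (n:ℝ) ^ 2) • 𝔸) (cellField W M hM ν hν.1 n) (fun x => (UnitAddTorus.mFourier ℓ x).re • p) w →
            ∀ᵐ t ∂(volume.restrict (Ioo 0 T)),
              ∫ x, ‖w t x‖ ^ 2 - lowEnergy ((n:ℝ) / 2) (w t)
                  ≤ C * (c * ‖Torus.latticeVec ℓ‖ ^ 2 / ((n:ℝ) ^ 2 * ν ^ 2)) * ∫ x, ‖(UnitAddTorus.mFourier ℓ x).re • p‖ ^ 2

/-- The energy conjunct is free (Temam energy inequality for every weak cell solution, `ae_energy_le_datum`). -/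
theorem cellEnergyClausesW_of_noE {k : ℕ} {W : LatticeShear.LatticeWord k} {M : ℝ} {hM : 0 < M} {c : ℝ} {lo hi Λ β C ν₀ K : ℝ}
    (hlo : 0 < lo) (hK : 0 < K) (h : CellEnergyClausesWNoE W M hM c lo hi Λ β C ν₀ K) : CellEnergyClausesW W M hM c lo hi Λ β C ν₀ K := by
  intro ν hν n 𝔸 hodd hwin'
  obtain ⟨hFcl, hCcl⟩ := h ν hν n 𝔸 hodd hwin'
  refine ⟨fun L hL hLn F hF hmodes T hT u hu => ?_, hCcl⟩
  have h1 := ae_energy_le_datum (hM := hM) hlo hν.1 (one_le_of_band hL hK hν.1 hLn) hwin' hF hu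
  have h2 := hFcl L hL hLn F hF hmodes T hT u hu
  filter_upwards [h1, h2] with t ht1 ht2
  exact ⟨ht1, ht2⟩

/-- (F) ⇒ (F_T): the re-cut is a WEAKENING of the registered clauses (`C ≥ 0`, `c ≥ 0`; `exp ≥ 1` on `t > 0`). -/
theorem cellEnergyClausesW_of_cellEnergyClauses {k : ℕ} {W : LatticeShear.LatticeWord k} {M : ℝ} {hM : 0 < M} {c : ℝ} {lo hi Λ β C ν₀ K : ℝ}
    (hc : 0 ≤ c) (hC : 0 ≤ C) (h : CellEnergyClauses W M hM c lo hi Λ β C ν₀ K) : CellEnergyClausesW W M hM c lo hi Λ β C ν₀ K := by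
  intro ν hν n 𝔸 hodd hwin'
  obtain ⟨hFcl, hCcl⟩ := h ν hν n 𝔸 hodd hwin'
  refine ⟨fun L hL hLn F hF hmodes T hT u hu => ?_, hCcl⟩
  have h2 := hFcl L hL hLn F hF hmodes T hT u hu
  filter_upwards [h2, ae_restrict_mem measurableSet_Ioo] with t ht htI
  refine ⟨ht.1, ht.2.trans ?_⟩
  have hA : 0 ≤ C * (c * L ^ 2 / ((n:ℝ) ^ 2 * ν ^ 2)) := mul_nonneg hC (by positivity)
  have hE : 0 ≤ ∫ x, ‖F x‖ ^ 2 := integral_nonneg fun x => by positivity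
  have hexp : 1 ≤ Real.exp (C * (L ^ 2 / ((n:ℝ) ^ 2 * ν)) * t) := by
    rw [← Real.exp_zero]
    exact Real.exp_le_exp.mpr (mul_nonneg (mul_nonneg hC (by have := hν.1; positivity)) htI.1.le)
  calc C * (c * L ^ 2 / ((n:ℝ) ^ 2 * ν ^ 2)) * ∫ x, ‖F x‖ ^ 2
      = (C * (c * L ^ 2 / ((n:ℝ) ^ 2 * ν ^ 2)) * 1) * ∫ x, ‖F x‖ ^ 2 := by rw [mul_one]
    _ ≤ (C * (c * L ^ 2 / ((n:ℝ) ^ 2 * ν ^ 2)) * Real.exp (C * (L ^ 2 / ((n:ℝ) ^ 2 * ν)) * t)) * ∫ x, ‖F x‖ ^ 2 :=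
        mul_le_mul_of_nonneg_right (mul_le_mul_of_nonneg_left hexp hA) hE

end

end Summit.AnomalousDissipation.AnomalousDissipation.Theorems.SolenoidalFractalHomogenisation.LagrangianStep
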